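import Summits.HodgeConjecture.CorCM.Census.CyclicCharacterNonrootCertificateK

/-!
# Cyclic characters, XLVIII: EVEN KERNEL, `d = 0` — THE LAW `μ = φ₂ = β − 2` for every `k ≥ 2`, and THE COMPLETE CYCLIC-CHARACTER LAW

COR-CM (cell `pub-hodgecm2`), count-neutral kernel combinatorics by the binder seat b09 (gen 44; lane CYCLIC-CHARACTER FIBRE LAW, part XLVIII), on part XLVII
(the interval-ruled certificate), gen 43ʼs shift machinery (`Census/CyclicCharacterSpectator.shift_mem_of_unitShifts`,
`Census/CyclicCharacterCyclicSylowLaw.shiftTop_mem_of_zeta_mem`, `isLeast_card_gfaces_generate_of_shift`) and gen 43ʼs `d = 1` law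
(`Census/CyclicCharacterCyclicSylowLaw.isLeast_card_gfaces_generate_of_roots`) BY NAME.  Theorems only (no definition, no `decide`, no certificate data, no
named fact, no `sorry`).  HONEST FRAMING: `HC_CM` is NOT proved, here or anywhere in the tree; nothing here is a period or a headline.

**THE `d = 0` LAW (`isLeast_card_gfaces_generate_of_even_nonroot`).**  `G` finite, `c` a central involution, `w : G ↠ ℤ/2ᵏ` (`k ≥ 2`) additive with
`w c ≠ 0`, `|ker w| = 2m ≥ 4`, and some `g` with `w g` odd has `c ∉ ⟨g⟩`.  Then the least number of G-faces whose translates together with the pairs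
generate the Hodge span is `μ(G, c) = φ₂(G, c) = β(G, c) − 2`.

**THE COMPLETE CYCLIC-CHARACTER LAW (`isLeast_card_gfaces_generate_of_cyclicCharacter`).**  For every finite `G`, central involution `c`, additive
`w : G ↠ ℤ/2ᵏ` (`k ≥ 2`) with `w c ≠ 0` and `|ker w| ≥ 3`: `μ(G, c) = φ₂(G, c)`; in closed form `μ = β − 1` if every `w`-odd element is a root of `c` and
`μ = β − 2` otherwise (gen 43ʼs `d = 1` law, gen 43/44ʼs even-kernel laws, and the remark that an odd kernel forces `d = 1`).  This completes the lane
CYCLIC-CHARACTER FIBRE LAW opened by gen 38: the conjectured census law `μ = φ₂` holds for every pair `(G, c)` admitting a cyclic `2`-power character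
that does not kill `c` and has at least three elements in its kernel.

## References
* [Pohlmann1968] H. Pohlmann, Algebraic cycles on abelian varieties of complex multiplication type, Ann. of Math. 88 (1968), Thm 1.
-/

namespace Summit.HodgeConjecture.CorCM.Census.CyclicCharacter

open Finset
open Summit.HodgeConjecture.CorCM.Prior.AllgGroup.RfwfAllgGroup
open Summit.HodgeConjecture.CorCM.Census.BlockParity
open Summit.HodgeConjecture.CorCM.Census.Coinvariant
open Summit.HodgeConjecture.CorCM.Census.TwistGeneration
open Summit.HodgeConjecture.CorCM.Census.BaseBlock

noncomputable section

variable {G : Type*} [Group G] [Fintype G] [DecidableEq G] {k : ℕ} {w : G → ZMod (2 ^ k)} {c : G}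

/-! ## §1 The `d = 0` law for every `k ≥ 2` -/

/-- **THE `d = 0` LAW (`k ≥ 2`, even kernel `≥ 4`): `μ(G, c) = φ₂(G, c)` and `φ₂(G, c) + 2 = β(G, c)`** — see the file header. [folklore] -/
theorem isLeast_card_gfaces_generate_of_even_nonroot [Fintype (CMF G c)] (hw : ∀ P Q : G, w (P * Q) = w P + w Q) (hk : 1 ≤ k) (hk2 : 2 ≤ k)
    (hc2 : c * c = 1) (hcen : ∀ x : G, x * c = c * x) (hwc : w c ≠ 0) (h1 : ∃ g₁ : G, w g₁ = 1)
    (hnon : ∃ g : G, ¬ 2 ∣ (w g).val ∧ c ∉ Subgroup.zpowers g)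
    {m : ℕ} (hm : 2 * m = (univ.filter fun s : G => w s = 0).card) (hm2 : 2 ≤ m) :
    IsLeast {n : ℕ | ∃ S : Finset (CMF G c →₀ ℤ), (↑S ⊆ gfaceSet G c hc2) ∧ S.card = n ∧
      hodgeSpan c hc2 ≤ Submodule.span ℤ (pairSet c) ⊔ Submodule.span ℤ (translates c S)} (fibreTwo c hc2) ∧
    fibreTwo c hc2 + 2 = Fintype.card (Block c) := by
  have hβ := fibreTwo_add_two_eq_card_block hw hk2 h1 hc2 hcen hwc hnon
  refine ⟨?_, hβ⟩
  obtain ⟨S₀, hS₀f, hcard, htw, ⟨t, ht0, hζt⟩, ⟨B', hB'F, hR⟩, hunit⟩ := exists_nonrootCertK hw hk hk2 hc2 hcen hwc h1 hnon hm hm2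
  have hcov := fun Φ => hcov_of_toward c (arcType hw hk hc2 hwc 0) hc2 S₀ htw Φ
  have hζ : ∀ s : G, w s = 0 →
      (Finsupp.single (oflipCM c hc2 s (arcType hw hk hc2 hwc 0)) (1 : ℤ) - Finsupp.single (arcType hw hk hc2 hwc 0) 1) +
        (Finsupp.single (oflipCM c hc2 s (arcType hw hk hc2 hwc 1)) (1 : ℤ) - Finsupp.single (arcType hw hk hc2 hwc 1) 1) ∈
          Submodule.span ℤ (pairSet c) ⊔ Submodule.span ℤ (translates c S₀) :=
    fun s hs => zeta_mem_of_zeta_mem hw hk hc2 hcen hwc S₀ ht0 hs hζt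
  have hfib := fib_mem_of_rel hw hk hc2 hwc _ hB'F hR fun s hs => hζ s (mem_filter.mp (mem_sdiff.mp hs).1).2
  have hshift : ∀ s ∈ ((arcType hw hk hc2 hwc 0)).1,
      Finsupp.single (oflipCM c hc2 s (arcType hw hk hc2 hwc 0)) (1 : ℤ) - Finsupp.single (arcType hw hk hc2 hwc 0) 1 -
        Finsupp.single (oflipCM c hc2 s (arcType hw hk hc2 hwc (w s))) 1 + Finsupp.single (arcType hw hk hc2 hwc (w s)) 1 ∈
          Submodule.span ℤ (pairSet c) ⊔ Submodule.span ℤ (translates c S₀) := by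
    intro s hs
    have hsv : (w s).val < 2 ^ (k - 1) := by have := (mem_arcType hw hk hc2 hwc 0 s).mp hs; rwa [sub_zero] at this
    have hws : w s = (((w s).val : ℕ) : ZMod (2 ^ k)) := (ZMod.natCast_zmod_val (w s)).symm
    by_cases htop : (w s).val = 2 ^ (k - 1) - 1
    · have hu : w s = ((2 ^ (k - 1) : ℕ) : ZMod (2 ^ k)) - 1 := by
        rw [hws, htop, Nat.cast_sub (Nat.one_le_two_pow), Nat.cast_one]
      exact shiftTop_mem_of_zeta_mem hw hk hc2 hcen hwc S₀ ht0 hu hζt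
    · have hle : (w s).val ≤ 2 ^ (k - 1) - 2 := by omega
      have h := shift_mem_of_unitShifts hw hk hc2 hcen hwc h1 S₀ (w s).val (fun j hj1 hj2 => hunit j hj1 (hj2.trans hle)) s hws
      rwa [← hws] at h
  have hcardφ : S₀.card ≤ fibreTwo c hc2 := by omega
  exact (isLeast_card_gfaces_generate_of_shift hw hk hc2 hcen hwc h1 S₀ hS₀f hcardφ hcov hshift hfib).2

/-- **THE `d = 0` LAW (`k ≥ 2`), block form: `μ(G, c) = β(G, c) − 2`.** [folklore] -/
theorem isLeast_card_gfaces_generate_of_even_nonroot_card_block [Fintype (CMF G c)] (hw : ∀ P Q : G, w (P * Q) = w P + w Q) (hk : 1 ≤ k)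
    (hk2 : 2 ≤ k) (hc2 : c * c = 1) (hcen : ∀ x : G, x * c = c * x) (hwc : w c ≠ 0) (h1 : ∃ g₁ : G, w g₁ = 1)
    (hnon : ∃ g : G, ¬ 2 ∣ (w g).val ∧ c ∉ Subgroup.zpowers g)
    {m : ℕ} (hm : 2 * m = (univ.filter fun s : G => w s = 0).card) (hm2 : 2 ≤ m) :
    IsLeast {n : ℕ | ∃ S : Finset (CMF G c →₀ ℤ), (↑S ⊆ gfaceSet G c hc2) ∧ S.card = n ∧
      hodgeSpan c hc2 ≤ Submodule.span ℤ (pairSet c) ⊔ Submodule.span ℤ (translates c S)} (Fintype.card (Block c) - 2) := by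
  obtain ⟨h, hβ⟩ := isLeast_card_gfaces_generate_of_even_nonroot hw hk hk2 hc2 hcen hwc h1 hnon hm hm2
  rw [← hβ, Nat.add_sub_cancel]
  exact h

/-! ## §2 The complete cyclic-character law -/

omit [DecidableEq G] in
/-- **AN ODD KERNEL FORCES `d = 1`**: if `|ker w|` is odd then `c ∈ ⟨g⟩` for every `g` with `w g` odd (indeed for every `g` with `w g ≠ 0`).
[folklore] -/
theorem c_mem_zpowers_of_odd_card_ker (hw : ∀ P Q : G, w (P * Q) = w P + w Q) (hk : 1 ≤ k) (hc2 : c * c = 1) (hcen : ∀ x : G, x * c = c * x)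
    (hwc : w c ≠ 0) (hodd : Odd (univ.filter fun s : G => w s = 0).card) {g : G} (hg : ¬ 2 ∣ (w g).val) : c ∈ Subgroup.zpowers g := by
  let K : Subgroup G :=
    { carrier := {g | w g = 0}
      mul_mem' := fun {a b} ha hb => by
        simp only [Set.mem_setOf_eq] at ha hb ⊢
        rw [hw, ha, hb, add_zero]
      one_mem' := map_one hw
      inv_mem' := fun {a} ha => by
        simp only [Set.mem_setOf_eq] at ha ⊢
        rw [map_inv hw, ha, neg_zero] }
  have hKcard : Nat.card K = (univ.filter fun s : G => w s = 0).card :=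
    Nat.subtype_card _ fun x => by rw [mem_filter]; exact ⟨fun h => h.2, fun h => ⟨mem_univ _, h⟩⟩
  have hodd' : ∀ g : G, w g = 0 → Odd (orderOf g) := fun g hg =>
    Odd.of_dvd_nat (by rw [hKcard]; exact hodd) (Subgroup.orderOf_dvd_natCard K (show g ∈ K from hg))
  have hg0 : w g ≠ 0 := fun h => by rw [h, ZMod.val_zero] at hg; exact hg (dvd_zero 2)
  exact c_mem_zpowers_of_apply_ne_zero hw hk hc2 hcen hwc hodd' hg0

/-- **THE COMPLETE CYCLIC-CHARACTER LAW: `μ(G, c) = φ₂(G, c)`** for every finite `G`, central involution `c`, additive `w : G ↠ ℤ/2ᵏ` (`k ≥ 2`) with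
`w c ≠ 0` and `|ker w| ≥ 3` — no hypothesis on the parity of the kernel or on the roots of `c`. [folklore] -/
theorem isLeast_card_gfaces_generate_of_cyclicCharacter [Fintype (CMF G c)] (hw : ∀ P Q : G, w (P * Q) = w P + w Q) (hk : 1 ≤ k) (hk2 : 2 ≤ k)
    (hc2 : c * c = 1) (hcen : ∀ x : G, x * c = c * x) (hwc : w c ≠ 0) (h1 : ∃ g₁ : G, w g₁ = 1)
    (h3 : 3 ≤ (univ.filter fun s : G => w s = 0).card) :
    IsLeast {n : ℕ | ∃ S : Finset (CMF G c →₀ ℤ), (↑S ⊆ gfaceSet G c hc2) ∧ S.card = n ∧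
      hodgeSpan c hc2 ≤ Submodule.span ℤ (pairSet c) ⊔ Submodule.span ℤ (translates c S)} (fibreTwo c hc2) := by
  by_cases hroots : ∀ g : G, ¬ 2 ∣ (w g).val → c ∈ Subgroup.zpowers g
  · exact (isLeast_card_gfaces_generate_of_roots hw hk hk2 hc2 hcen hwc h1 hroots h3).1
  · push Not at hroots
    obtain ⟨g, hg, hgc⟩ := hroots
    obtain ⟨m, hm | hm⟩ := Nat.even_or_odd' ((univ.filter fun s : G => w s = 0).card)
    · exact (isLeast_card_gfaces_generate_of_even_nonroot hw hk hk2 hc2 hcen hwc h1 ⟨g, hg, hgc⟩ hm.symm (by omega)).1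
    · exact absurd (c_mem_zpowers_of_odd_card_ker hw hk hc2 hcen hwc ⟨m, hm⟩ hg) hgc

/-- **THE COMPLETE CYCLIC-CHARACTER LAW, closed form**: under the same hypotheses `μ(G, c) = β(G, c) − 1` if every `w`-odd element is a root of `c`,
and `μ(G, c) = β(G, c) − 2` otherwise. [folklore] -/
theorem isLeast_card_gfaces_generate_of_cyclicCharacter_card_block [Fintype (CMF G c)] (hw : ∀ P Q : G, w (P * Q) = w P + w Q) (hk : 1 ≤ k)
    (hk2 : 2 ≤ k) (hc2 : c * c = 1) (hcen : ∀ x : G, x * c = c * x) (hwc : w c ≠ 0) (h1 : ∃ g₁ : G, w g₁ = 1)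
    (h3 : 3 ≤ (univ.filter fun s : G => w s = 0).card) :
    IsLeast {n : ℕ | ∃ S : Finset (CMF G c →₀ ℤ), (↑S ⊆ gfaceSet G c hc2) ∧ S.card = n ∧
      hodgeSpan c hc2 ≤ Submodule.span ℤ (pairSet c) ⊔ Submodule.span ℤ (translates c S)}
      (if (∀ g : G, ¬ 2 ∣ (w g).val → c ∈ Subgroup.zpowers g) then Fintype.card (Block c) - 1 else Fintype.card (Block c) - 2) := by
  have h := isLeast_card_gfaces_generate_of_cyclicCharacter hw hk hk2 hc2 hcen hwc h1 h3
  split_ifs with hroots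
  · rw [← (isLeast_card_gfaces_generate_of_roots hw hk hk2 hc2 hcen hwc h1 hroots h3).2, Nat.add_sub_cancel]; exact h
  · push Not at hroots
    obtain ⟨g, hg, hgc⟩ := hroots
    rw [← fibreTwo_add_two_eq_card_block hw hk2 h1 hc2 hcen hwc ⟨g, hg, hgc⟩, Nat.add_sub_cancel]; exact h

/-- **THE FIBRE COUNT IN CLOSED FORM**: under the same hypotheses `φ₂(G, c) = β(G, c) − 1` if every `w`-odd element is a root of `c`, and
`φ₂(G, c) = β(G, c) − 2` otherwise. [folklore] -/
theorem fibreTwo_eq_card_block_sub [Fintype (CMF G c)] (hw : ∀ P Q : G, w (P * Q) = w P + w Q) (hk : 1 ≤ k)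
    (hk2 : 2 ≤ k) (hc2 : c * c = 1) (hcen : ∀ x : G, x * c = c * x) (hwc : w c ≠ 0) (h1 : ∃ g₁ : G, w g₁ = 1)
    (h3 : 3 ≤ (univ.filter fun s : G => w s = 0).card) :
    fibreTwo c hc2 = if (∀ g : G, ¬ 2 ∣ (w g).val → c ∈ Subgroup.zpowers g) then Fintype.card (Block c) - 1 else Fintype.card (Block c) - 2 :=
  (isLeast_card_gfaces_generate_of_cyclicCharacter hw hk hk2 hc2 hcen hwc h1 h3).unique
    (isLeast_card_gfaces_generate_of_cyclicCharacter_card_block hw hk hk2 hc2 hcen hwc h1 h3)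

end

end Summit.HodgeConjecture.CorCM.Census.CyclicCharacter
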